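import Summits.AtomisticToContinuum.HydrodynamicLimit.Theses.AntiMazurCoboundaries
import Literature.MathematicalPhysics.KineticTheory.HardSphereEulerProofs
import Literature.Analysis.FluidPDE.EmpiricalCollisionMeasure

/-!
# Line `kinetic-entropy-collision-budget` — crux `AntiMazurCoboundaries.CorrectorPressureDecay`
(stmt-AtomisticToContinuum-14135)

Skeleton (crux-plan, round 1) of crux idea `kinetic-entropy-collision-budget` (ideator 2; triage r1-2 PASS,
r1-3 PASS with note). Six registered stubs, composition kernel-checked, `CorrectorPressureDecay_of` concludes the
route decl BY NAME. Gen 1 (planner-cruxplan-…-kinetic-entropy-coll-0) cut and typed the line; gen 2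
(planner-cruxplan-…-kinetic-entropy-coll-g2-0, 2026-08-16) re-audited every stub statement for truth as a Lean
proposition (junk values, `klDiv`/`rnDeriv`/`tilted` conventions, negative lags, record double-counting, measurability
of collision sums and window integrals — all consistent, see the line card §Gen-2 audit), re-read `Disproof.lean` v5
and the landed `Negative/` lemmas (no stub is an instance), corrected two overclaims in the docstring of the open stub
(its negation does NOT refute the crux; the `C·K/H` allowance is absorbable into `η`), and changed NO statement: the six
`def`s, the six `stub_*` and the composition are byte-identical to the registered gen-1 skeleton.

THE LEVER (card). Under the flow-invariant global Gibbs law `G_N` (hard-core positions ⊗ i.i.d. Maxwellian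
velocities) the ONE-BODY velocity law of ANY state of relative entropy `K` stays within relative entropy `K` of the
Maxwellian at all times (superadditivity over a product reference + Liouville invariance: the BUDGET); its change is
an exact sum over COLLISION RECORDS (velocities move only at collisions: the PRODUCTION identity); and the crux's
clause `g ⊥ span(1,v,|v|²)` makes the `g`-bias of a one-body law split EXACTLY into a first-order FAST-sector term
(distance of `√(f/γ) − 1` to the collision invariants — the directions on which Boltzmann's dissipation is coercive by
the PROVED linearised hard-sphere gap) plus a second-order term paid by entropy, which is where `∃κ` enters.

THE CUT (triage sharpenings acted on). Time is DISCRETISED: the window is the `n` sample times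
`lag, 2·lag, …, n·lag` of span `H·ℓ_N` (`ℓ_N = (N+1)^{-1/3}`), because the discrete Fejér corrector
`W = −lag Σ_{k<n} (1 − k/n) F∘Φ_{k·lag}` satisfies `F − lag⁻¹(W∘Φ_lag − W) = n⁻¹ Σ_{j=1}^{n} F∘Φ_{j·lag}` EXACTLY
(`G_N`-a.e., group law on the good set): the crux's defect integral IS the exponential moment of a discrete window
average (`stub_discreteFejerCorrector`, the owed transfer (F0) of triage r1-3 in its exact discrete form — no
within-lag shot noise, no passage through shared 10967, and `lag = Hℓ_N/n` with `n` free honours lag rigidity,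
crux NOTES S3). Only the OPTIMISER `Q = G_N.tilted(2·avg)` matters (Gibbs variational principle,
`stub_gibbsOneBodyDuality`), and all one-body objects are read off ONE probability law on `𝕋³ × ℝ³`: the
symmetrised, window-averaged, POSITION-CONDITIONAL one-body law `Π̄` of `(x_I(t_J), ṽ_I(t_J))` (`I, J` uniform) —
triage r1-2's "type the budget for the symmetrised marginal" — whose `g`-moment is the bias exactly, whose
conditional entropy obeys `(N+1)·KL(Π̄ ‖ Π̄ˣ⊗γ) ≤ KL(Q ‖ G_N)` (`stub_oneBodyEntropyBudget`: the card's FIRST LEMMA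
in the crux frame; joint convexity — the reference `Π̄ˣ ⊗ γ` is LINEAR in `Π̄` — so no permutation symmetry of `Φ`
and no cells are needed), and whose bias obeys the exact Hellinger split (`stub_hellingerBiasSplit`). The literal
`HellingerCoercivity` of the card is FALSE on `M_{1+s}` (triage r1-3 §C.3) and is NOT a stub: the open content is cut
one level up, at the FAST-SECTOR DOMINANCE `stub_fastSectorDominance` ((S″): the window optimiser's `Π̄` is
fast-Maxwellian up to `C·K/H + A·K²/(N+1) + η(N+1)` — the `A·K²` allowance is exactly the local-Maxwellian
curvature `‖u^⊥‖ ≈ 0.34 s²` at entropy `s²`, paid by the κ-clause), with (S′) + DEFECTIVE coercivity + one-body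
log-density locality recorded as its proof route; the exact collision-record lever enters as the TRUE stub
`stub_collisionTransportIdentity` (one-body Lagrangian collision-transport identity with time-dependent tests,
version-free form of "production is a pure collision sum"), which the open stub takes as antecedent.

COMPOSITION (proved below, no sorry): `correctorPressureDecay_of_parts` — quantifier plumbing + the κ-clause
arithmetic `pressure_arith`: with `κ := min κ₁ (16(√A+1))⁻¹`, `η := δ²/(64(κ²+1))`, `H := max H₁ (32κ²C/δ + 1)`,
`τ₀ := 4κH/δ + 1`, `lag := Hℓ_N/n`: `E_Q[2A] − K ≤ 4κ(N+1)√fd + 2κK − K ≤ K/4 + 16κ²C(N+1)/H + K/4 + δ(N+1)/2 + K/2 − K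
≤ δ(N+1)`, then Gibbs duality gives the discrete-window moment bound and the Fejér corrector gives both clauses of X.

DISPROOF USED (`Cruxes/CorrectorPressureDecay/Disproof.lean`, cdisprove v5 of 2026-08-16T02:31Z — NO KILL —, + landed `Theorems/CorrectorPressureDecay/Negative/`
`Frame`, `WithoutOrthogonality`, `Statics`, `AllAmplitudes`, `AmplitudeWitness`): (a.1) `g ⊥ 1` (and `⊥ v, |v|²`)
is USED in `stub_hellingerBiasSplit` (`∫ g r dγ = ∫ g (r−1) dγ`, and the fibrewise projection); (a.2) `∃κ` is USED
in `pressure_arith` (`4κ√A·K ≤ K/4`, `2κK ≤ K/2`) — for `κ > κ*` the open stub's `A`-allowance cannot be absorbed,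
matching `correctorPressureDecay_false_without_amplitude`; (a.3) `σ > 0` lives in `stub_fastSectorDominance` (at
`σ = 0` there are no records, `g(ṽᵢ)` is frozen, the optimiser is asymptotically the static product tilt by `2(∫φ)Σᵢg(ṽᵢ)`
and its fast deviation stays FIRST order, `fd ≍ K/(N+1)` for every `H` — violating the bound for small `η`, as it must);
(c.1) `W = 0` refuted — our `W` is the discrete Fejér corrector; (e).6 is `stub_discreteFejerCorrector` made exact;
v5's positive by-product `HomInv.homogeneousInvariance` (HomogeneousInvariance 9621 for ALL drifts) and the landed
tree fact `measurePreserving_flow_localGibbsLaw_const` (Theorems/JParityClosureOddContactSymmetryGibbsInvariance) supply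
the invariance `Φ_t # G_N = G_N` consumed by `stub_oneBodyEntropyBudget` and `stub_gibbsOneBodyDuality` — no invariance
stub is needed. Negatives index (12, re-read gen 2): none instanced (all stubs quantify over probability laws / tilts of
`G_N`; flow junk is null; `g` continuous).
-/

noncomputable section

open MeasureTheory ProbabilityTheory InformationTheory Set Filter Topology
open scoped ENNReal

namespace Summit.AtomisticToContinuum.HydrodynamicLimit.Cruxes.CorrectorPressureDecay.KineticEntropyCollisionBudget

open Literature.MathematicalPhysics.KineticTheory (T3 V3 hsDiameter localGibbsLaw)
open Literature.Analysis.FluidPDE (HardSphereFlow Config)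
open Summit.AtomisticToContinuum.HydrodynamicLimit.Theses.AntiMazurCoboundaries (CorrectorPressureDecay)

/-! ## Frame abbreviations (reducible; the crux decl is matched by unfolding) -/

/-- Hard-sphere flows of `N + 1` spheres of reduced diameter `σ` on `𝕋³` (the crux's `Φ`). -/
abbrev Flow (σ : ℝ) (N : ℕ) : Type :=
  HardSphereFlow (Literature.Analysis.FluidPDE.Torus.geometry (Fin 3)) (hsDiameter σ N) (N + 1)

/-- Phase space of `N + 1` spheres on `𝕋³`. -/
abbrev Phase (N : ℕ) : Type := Config (N + 1) (Fin 3) T3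

/-- The flow-invariant global Gibbs law `G_N` of the crux (constant profiles `a, u₀, θ`). -/
abbrev gibbs (σ a θ : ℝ) (u₀ : V3) (N : ℕ) (Φ : Flow σ N) : Measure (Phase N) :=
  localGibbsLaw σ (fun _ => a) (fun _ => u₀) (fun _ => θ) N Φ

/-- The microscopic length/time unit `ℓ_N = (N+1)^{-1/3}` (the crux's `h₀ = τ₀ ℓ_N`). -/
abbrev scale (N : ℕ) : ℝ := ((N + 1 : ℕ) : ℝ) ^ (-(1 / 3 : ℝ))

/-- Standardised velocity `ṽ = (w − u₀)/√θ` (so that `ṽ ~ stdGaussian` under `G_N`). -/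
abbrev stdVel (θ : ℝ) (u₀ : V3) (w : V3) : V3 := (Real.sqrt θ)⁻¹ • (w - u₀)

/-- The fast one-body observable `F(z) = Σᵢ φ(xᵢ) g((vᵢ − u₀)/√θ)` of the crux (literal spelling). -/
abbrev fluxObs (θ : ℝ) (u₀ : V3) (φ : T3 → ℝ) (g : V3 → ℝ) (N : ℕ) (z : Phase N) : ℝ :=
  ∑ i, φ (z i).1 * g ((Real.sqrt θ)⁻¹ • ((z i).2 - u₀))

/-! ## The discrete kinetic window and its optimiser -/

/-- DISCRETE WINDOW AVERAGE of an observable along the flow over the `n` sample times `lag, 2·lag, …, n·lag`: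
`A(z) = n⁻¹ Σ_{j<n} F(Φ_{(j+1)·lag} z)`. With the discrete Fejér corrector this is EXACTLY `F − D_W` (a.e.). -/
def discAvg {σ : ℝ} {N : ℕ} (Φ : Flow σ N) (F : Phase N → ℝ) (n : ℕ) (lag : ℝ) (z : Phase N) : ℝ :=
  (n : ℝ)⁻¹ * ∑ j : Fin n, F (Φ.flow ((((j : ℕ) : ℝ) + 1) * lag) z)

/-- THE OPTIMISER of the window pressure: the global Gibbs law tilted by twice the discrete window average of the
flux observable, `Q = e^{2A} G_N / Z` (Gibbs variational principle: `log Z = E_Q[2A] − KL(Q ‖ G_N)`). -/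
def optimiser (σ a θ : ℝ) (u₀ : V3) (N : ℕ) (Φ : Flow σ N) (φ : T3 → ℝ) (g : V3 → ℝ) (n : ℕ) (lag : ℝ) :
    Measure (Phase N) :=
  (gibbs σ a θ u₀ N Φ).tilted (fun z => 2 * discAvg Φ (fluxObs θ u₀ φ g N) n lag z)

/-! ## One-body laws on `𝕋³ × ℝ³` and their three functionals -/

/-- Position and standardised velocity of particle `i` at time `t`. -/
def oneBodyObs (θ : ℝ) (u₀ : V3) {σ : ℝ} {N : ℕ} (Φ : Flow σ N) (t : ℝ) (i : Fin (N + 1)) (z : Phase N) :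
    T3 × V3 :=
  ((Φ.flow t z i).1, stdVel θ u₀ (Φ.flow t z i).2)

/-- THE SYMMETRISED WINDOW-AVERAGED ONE-BODY LAW `Π̄` of a state `P`: the law of `(x_I(t_J), ṽ_I(t_J))` for a
uniformly chosen particle `I` and sample index `J` (`t_J = (J+1)·lag`), a probability law on `𝕋³ × ℝ³` when `P` is
(and `1 ≤ n`). Its `φ⊗g`-moment is the window bias: `E_P[2A] = 2(N+1) ∫ φ(x) g(v) dΠ̄`. -/
def windowOneBodyLaw (θ : ℝ) (u₀ : V3) {σ : ℝ} {N : ℕ} (Φ : Flow σ N) (P : Measure (Phase N)) (n : ℕ)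
    (lag : ℝ) : Measure (T3 × V3) :=
  ((((N + 1 : ℕ) : ℝ≥0∞))⁻¹ * ((n : ℝ≥0∞))⁻¹) •
    ∑ i : Fin (N + 1), ∑ j : Fin n, P.map (oneBodyObs θ u₀ Φ ((((j : ℕ) : ℝ) + 1) * lag) i)

/-- The locally-Maxwellian reference of a one-body law: its OWN position marginal times the standard Gaussian. -/
def condRef (π : Measure (T3 × V3)) : Measure (T3 × V3) :=
  π.fst.prod (stdGaussian V3)

/-- CONDITIONAL VELOCITY ENTROPY `KL(π ‖ πˣ ⊗ γ) = ∫ KL(π(·|x) ‖ γ) dπˣ` (chain rule). -/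
def condKL (π : Measure (T3 × V3)) : ℝ≥0∞ :=
  klDiv π (condRef π)

/-- The HELLINGER VARIABLE `u(x,v) = √r(x,v) − 1`, `r = dπ/d(πˣ ⊗ γ)` the position-conditional velocity density
w.r.t. the Gaussian (`f = γ(1+u)²` fibrewise; `‖u(x,·)‖²_γ = 2 − 2∫√r ≤ KL`). -/
def hellingerDev (π : Measure (T3 × V3)) (p : T3 × V3) : ℝ :=
  Real.sqrt ((π.rnDeriv (condRef π) p).toReal) - 1

/-- FAST DEFECT of a velocity function: its squared `L²(γ)`-distance to the collision invariants
`span(1, v, |v|²)`, written junk-free as an infimum over the quadratic weights `c₀ + ⟪b,v⟫ + c₂|v|²` of the crux's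
own orthogonality clause. Local Maxwellians are NOT in the null set: `dist(√(M_{1+s}/γ) − 1) ≈ 0.34 s²`. -/
def fastDefect (w : V3 → ℝ) : ℝ≥0∞ :=
  ⨅ q : ℝ × V3 × ℝ,
    ∫⁻ v, ENNReal.ofReal ((w v - (q.1 + inner ℝ q.2.1 v + q.2.2 * ‖v‖ ^ 2)) ^ 2) ∂(stdGaussian V3)

/-- FAST (non-hydrodynamic) DEVIATION of a one-body law: the position-averaged fast defect of its Hellinger
variable, `fd(π) = ∫ dist²_{L²(γ)}(u(x,·), span(1,v,|v|²)) dπˣ(x)` (`≤ 2`). -/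
def fastDev (π : Measure (T3 × V3)) : ℝ≥0∞ :=
  ∫⁻ x, fastDefect (fun v => hellingerDev π (x, v)) ∂π.fst

/-! ## Stub statements -/

/-- Statement of `stub_gibbsOneBodyDuality` — **Gibbs variational principle for the window optimiser, in one-body
form** (TRUE, size M). In the crux frame (`0 < σ ≤ 1/2`, so `G_N` is a probability measure; `φ, g` continuous and
bounded; `1 ≤ n`, any `lag`): the optimiser `Q = G_N.tilted(2A)` is a probability measure, `Q ≪ G_N`,
`KL(Q ‖ G_N) < ∞` (bounded log-density `2A − log Z`), and for every `B`,
`2(N+1) ∫ φ(x) g(v) dΠ̄(Q) − KL(Q ‖ G_N) ≤ B ⟹ ∫ e^{2A} dG_N ≤ e^B` — because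
`log ∫ e^{2A} dG_N = E_Q[2A] − KL(Q ‖ G_N)` EXACTLY (Gibbs / Donsker–Varadhan, equality at the tilt) and
`E_Q[2A] = 2 n⁻¹ Σ_j E_Q[F∘Φ_{t_j}] = 2(N+1) ∫ φ⊗g dΠ̄(Q)` (push-forward + finite sums). Tools: `Measure.tilted`,
`isProbabilityMeasure_tilted`, `tilted_absolutelyContinuous`, `integral_tilted`; tree
`Literature.Probability.Divergences.integral_le_toReal_klDiv_add_integral` (the DV half), `integral_finset_sum_measure`. -/
def GibbsOneBodyDuality : Prop :=
  ∀ (σ a θ : ℝ) (u₀ : V3), 0 < σ → σ ≤ 1 / 2 → 0 < a → 0 < θ →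
    ∀ (N : ℕ) (Φ : Flow σ N) (φ : T3 → ℝ) (g : V3 → ℝ), Continuous φ → Continuous g →
      (∃ C : ℝ, ∀ x, |φ x| ≤ C) → (∃ C : ℝ, ∀ v, |g v| ≤ C) →
      ∀ (n : ℕ) (lag : ℝ), 1 ≤ n →
        IsProbabilityMeasure (optimiser σ a θ u₀ N Φ φ g n lag) ∧
        optimiser σ a θ u₀ N Φ φ g n lag ≪ gibbs σ a θ u₀ N Φ ∧
        klDiv (optimiser σ a θ u₀ N Φ φ g n lag) (gibbs σ a θ u₀ N Φ) ≠ ∞ ∧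
        ∀ B : ℝ,
          2 * ((N : ℝ) + 1) *
                ∫ p, φ p.1 * g p.2 ∂(windowOneBodyLaw θ u₀ Φ (optimiser σ a θ u₀ N Φ φ g n lag) n lag) -
              (klDiv (optimiser σ a θ u₀ N Φ φ g n lag) (gibbs σ a θ u₀ N Φ)).toReal ≤ B →
          ∫⁻ z, ENNReal.ofReal (Real.exp (2 * discAvg Φ (fluxObs θ u₀ φ g N) n lag z)) ∂(gibbs σ a θ u₀ N Φ)
            ≤ ENNReal.ofReal (Real.exp B)

/-- Statement of `stub_oneBodyEntropyBudget` — **the one-body entropy budget, crux frame** (TRUE, size M/L; the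
card's FIRST LEMMA `VelocityEntropyBudget` / `CellConditionalVelocityEntropyBudget`, sharpened as triage r1-2 asks:
symmetrised marginal, conditional on the CURRENT position instead of cells). For every probability law `P` on phase
space, `Π̄(P)` is a probability law and `(N+1) · KL(Π̄ ‖ Π̄ˣ ⊗ γ) ≤ KL(P ‖ G_N)`. Proof chain (all ≤):
`(N+1)KL(Π̄‖Π̄ˣ⊗γ) ≤ Σ_i KL(π̄_i‖π̄_iˣ⊗γ) ≤ Σ_i n⁻¹Σ_j KL(J_{ij}‖J_{ij}ˣ⊗γ)` (JOINT convexity of `klDiv`: the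
reference `πˣ ⊗ γ` is LINEAR in `π`), `Σ_i KL(J_{ij}‖J_{ij}ˣ⊗γ) ≤ KL(P_{t_j}‖G_N)` (bijection to
`(x, ṽ)`-coordinates, `G_N ↦ Ξ_N ⊗ γ^{⊗(N+1)}`; chain rule `KL = KL(Pˣ‖Ξ) + E_x KL(P^{ṽ|x}‖γ^⊗)`; superadditivity over
the i.i.d. velocity factors; conditioning on `x_i` only, by convexity), and `KL(P_{t}‖G_N) = KL(Φ_t#P ‖ Φ_t#G_N) ≤
KL(P‖G_N)` (data processing; INVARIANCE `Φ_t#G_N = G_N` = route support HomogeneousInvariance stmt-9621, proved for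
constant profiles in `Theorems/JParityClosureOddContactSymmetryGibbsInvariance.lean`,
`measurePreserving_flow_localGibbsLaw_const`). Trivial when `KL(P‖G_N) = ∞`. Tools: tree
`klDiv_map_fst_add_klDiv_map_snd_le`, `klDiv_map_of_measurableEmbedding`, `klDiv_comp_le` (StrongDataProcessingProofs),
`lintegral_prod_vel_localGibbsMeasure` (Negative/Frame: the product structure of `G_N`). -/
def OneBodyEntropyBudget : Prop :=
  ∀ (σ a θ : ℝ) (u₀ : V3), 0 < σ → σ ≤ 1 / 2 → 0 < a → 0 < θ →
    ∀ (N : ℕ) (Φ : Flow σ N) (n : ℕ) (lag : ℝ), 1 ≤ n →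
      ∀ P : Measure (Phase N), IsProbabilityMeasure P →
        IsProbabilityMeasure (windowOneBodyLaw θ u₀ Φ P n lag) ∧
        ((N + 1 : ℕ) : ℝ≥0∞) * condKL (windowOneBodyLaw θ u₀ Φ P n lag) ≤ klDiv P (gibbs σ a θ u₀ N Φ)

/-- Statement of `stub_hellingerBiasSplit` — **the exact bias split in Hellinger variables** (TRUE, size M; abstract,
one law on `𝕋³ × ℝ³`; this is where the crux's `g ⊥ span(1,v,|v|²)` and `∃κ` enter). For a probability law `π` with
finite conditional velocity entropy, measurable `|φ| ≤ 1`, `|g| ≤ κ`, `g ⊥ c₀ + ⟪b,v⟫ + c₂|v|²` in `L²(γ)`: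
`fd(π) < ∞` and `∫ φ(x) g(v) dπ ≤ 2κ √fd(π) + κ · KL(π ‖ πˣ⊗γ)`. Proof: disintegrate, `r(x,·)` a probability
density w.r.t. `γ` for `πˣ`-a.e. `x`, `u = √r − 1`; `∫ g r dγ = ∫ g(r − 1) dγ` (`g ⊥ 1`) `= 2⟨g,u⟩_γ + ⟨g,u²⟩_γ`;
`⟨g,u⟩ = ⟨g, u − q⟩` for every quadratic weight `q` (orthogonality) so `|⟨g,u⟩| ≤ ‖g‖_γ dist(u, span) ≤ κ√(fastDefect u)`;
`|⟨g,u²⟩| ≤ κ‖u‖² = κ(2 − 2∫√r dγ) ≤ κ KL(rγ‖γ)` (Jensen: `∫ r log r ≥ −2 log ∫√r ≥ 2(1 − ∫√r)`); integrate in `x`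
against `πˣ` with `|φ| ≤ 1`, Jensen for `√·`, chain rule for `condKL`. Mathlib: `Measure.rnDeriv`, `klDiv`,
`integral_prod`, `Real.add_pow_le_pow_mul_pow_of_sq_le_sq`/Cauchy–Schwarz in `L²(γ)`. -/
def HellingerBiasSplit : Prop :=
  ∀ (π : Measure (T3 × V3)), IsProbabilityMeasure π → condKL π ≠ ∞ →
    ∀ (φ : T3 → ℝ) (g : V3 → ℝ) (κ : ℝ), Measurable φ → Measurable g →
      (∀ x, |φ x| ≤ 1) → (∀ v, |g v| ≤ κ) →
      (∀ (c₀ c₂ : ℝ) (b : V3),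
        ∫ v, g v * (c₀ + inner ℝ b v + c₂ * ‖v‖ ^ 2) ∂(stdGaussian V3) = 0) →
      fastDev π ≠ ∞ ∧
      ∫ p, φ p.1 * g p.2 ∂π ≤ 2 * κ * Real.sqrt ((fastDev π).toReal) + κ * (condKL π).toReal

/-- Statement of `stub_collisionTransportIdentity` — **one-body Lagrangian observables change only through
collision records** (TRUE, size M/L; the version-free form of the card's lever "the production is a pure collision
sum because the observable is one-body in velocity"). In the crux frame, for a probability law `P ≪ G_N` under which
the number of collisions in `(0,T]` is integrable, every particle `i` and every bounded test `ψ(t, (x, v))` that is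
`C¹` in `t` with bounded continuous `∂_t ψ`:
`E_P[ψ(T, x_i(0), ṽ_i(T))] − E_P[ψ(0, x_i(0), ṽ_i(0))]
   = E_P[ Σ_{records c ∈ (0,T], c.fst = i} (ψ(t_c, x_i(0), ṽ(c.postVel.1)) − ψ(t_c, x_i(0), ṽ(c.preVel.1))) ]
     + E_P[ ∫₀ᵀ (∂_t ψ)(t, x_i(0), ṽ_i(t)) dt ]`.
Pathwise on the good set (conull for `P ≪ G_N ≪ Liouville`): `t ↦ ṽ_i(t)` is piecewise constant with finitely
many jumps in `[0,T]`, exactly at the records with `fst = i` (free flight keeps velocities; a collision moves only the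
colliding pair; orbits are right-continuous = post-collisional, `IsHardSphereTrajectory`), so FTC-with-jumps gives the
identity for each `z`; integrate (`|Σ| ≤ 2‖ψ‖∞ · #records`, integrable by hypothesis). With `ψ = log f_t` (mollified
in `t`) and the label `x_i(0)` this is the card's EXACT entropy-production identity
`(N+1)[h(0) − h(T)] = 𝒫_T` record by record (Maxwellian factors cancel by energy conservation), the input of
`stub_fastSectorDominance`. Tools: `HardSphereFlow.collisionSum`, `collisionPairSum_eq_finsum_ite`,
`integral_empiricalCollisionMeasure`, `IsHardSphereTrajectory.eq_freeFlight`, `HardSphereFlow.measurable_flow_prod_torus`. -/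
def CollisionTransportIdentity : Prop :=
  ∀ (σ a θ : ℝ) (u₀ : V3), 0 < σ → σ ≤ 1 / 2 → 0 < a → 0 < θ →
    ∀ (N : ℕ) (Φ : Flow σ N) (P : Measure (Phase N)), IsProbabilityMeasure P → P ≪ gibbs σ a θ u₀ N Φ →
      ∀ T : ℝ, 0 ≤ T →
        Integrable (fun z => Φ.collisionSum (Set.Ioc 0 T) (fun _ => (1 : ℝ)) z) P →
        ∀ (i : Fin (N + 1)) (ψ : ℝ → T3 × V3 → ℝ),
          Continuous (Function.uncurry ψ) → (∃ C : ℝ, ∀ t p, |ψ t p| ≤ C) →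
          (∀ p, Differentiable ℝ (fun t => ψ t p)) →
          Continuous (Function.uncurry fun t p => deriv (fun s => ψ s p) t) →
          (∃ C : ℝ, ∀ t p, |deriv (fun s => ψ s p) t| ≤ C) →
          (∫ z, ψ T ((z i).1, stdVel θ u₀ (Φ.flow T z i).2) ∂P) -
              ∫ z, ψ 0 ((z i).1, stdVel θ u₀ (Φ.flow 0 z i).2) ∂P =
            (∫ z, Φ.collisionSum (Set.Ioc 0 T)
                (fun c => if c.fst = i then
                    ψ c.time ((z i).1, stdVel θ u₀ c.postVel.1) - ψ c.time ((z i).1, stdVel θ u₀ c.preVel.1)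
                  else 0) z ∂P) +
              ∫ z, (∫ t in (0 : ℝ)..T, deriv (fun s => ψ s ((z i).1, stdVel θ u₀ (Φ.flow t z i).2)) t) ∂P

/-- Statement of `stub_fastSectorDominance` — **(S″) FAST-SECTOR DOMINANCE for the window optimiser** (OPEN, size
XL, the HARDEST stub; strictly stronger than the crux, a mechanism not a restatement: it says HOW the pressure dies —
the window optimiser's one-body law is first-order non-Maxwellian in the fast sector only for `O(t_rel)` total time).
GIVEN the exact collision-transport identity: in the crux frame there are `σ₀`, then for `0 < σ < σ₀` an amplitude
`κ₁ > 0` and constants `A, C ≥ 0` (depending on `a, θ, σ` only — `C ≍ t_rel/ℓ_N ≍ (σ²√θ)⁻¹` in units of `ℓ_N`, `A ≍`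
the local-Maxwellian Hellinger curvature) such that for all admissible `φ, g` (`|g| ≤ κ₁`), every `η > 0`, all
windows `H ≥ H₁(φ,g,η)` (span `H·ℓ_N`), all `N ≥ N₀` and every flow there is a sample number `n ≥ 1`
(`lag = Hℓ_N/n`) with, for the optimiser `Q` and `K = KL(Q‖G_N)`:
`(N+1) · fd(Π̄(Q)) ≤ C·K/H + A·K²/(N+1) + η·(N+1)`.
Why plausibly true: linear response of `Q`'s one-body law to the tilt (`2/n` per sample time, i.e. `2/H` per unit
window length) gives `‖u^⊥_{t_j}‖ ≍ κ(1/n + t_rel/(Hℓ_N))` at EVERY sample time (two-sided sum of the decaying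
autocorrelation of `g`; one-sided near the window ends, never larger), so for `n` large the averaged law has
`fd(Π̄) ≍ κ²t_rel²/(Hℓ_N)²` per particle — `o(1)` as `H → ∞`, inside the `η`-term; global `(P,E)`-shifts and long
hydrodynamic tilts of size `s²` have `fd ≍ s⁴ ≍ (K/(N+1))²` sustained (the `A`-term, triage r1-3 §C.3 — NOT slack,
and amplitude-independent); `O(ℓ_N∇φ)` transport effects vanish as `N → ∞` at fixed `H` (again the `η`-term). NOTE
(gen 2): since `E_{G_N}[A] = 0` (`g ⊥ 1`) gives `log Z ≥ 0` and hence `K ≤ 2κ₁(N+1)`, the `C·K/H` allowance is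
`≤ 2Cκ₁(N+1)/H`, absorbable into `η(N+1)` for `H ≥ H₁(η)`: the stub's whole content is "per particle, the fast
Hellinger deviation of the window optimiser's averaged one-body law is SECOND order in its entropy, `fd ≤ A·k² + o_H(1)`
(`k = K/(N+1)`, thermodynamic limit first)" — the `C`-term is kept only as prover's convenience. PROOF ROUTE (card +
triage): (S′)
time-integrated Boltzmann dissipation of the optimiser's one-body law `Σ_j 𝒫_B(t_j) ≤ [C′K + A′K²H/(N+1) + o(H)]·ν`
via the production identity (antecedent) and the sub-dominance (S) of the incoming-correlation feed (equilibrium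
ring kernel in `L¹(dt)`, `d = 3` transience); then DEFECTIVE Hellinger coercivity near `γ`,
`𝒦(√f) ≥ (1−η′)4λ‖u^⊥‖² − C_{η′} KL(f)²` (linear part = the PROVED gap
`le_neg_maxwellianInner_hardSphereLinearizedOp_of_orthogonal_holds`; the literal `𝒦 ≥ c‖u^⊥‖²` is FALSE on `M_{1+s}`)
plus N-uniform smallness of the optimiser's one-body log-density (first-moment influence locality, cf. 13916).
Why it might fail: a window-tilted near-equilibrium family whose averaged one-body law keeps a FIRST-order fast deviation
(`fd ≍ k`, not `k²`) as `H → ∞` uniformly in `N` — a hidden extensive quasi-local charge with a fast one-body component.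
Logical position (gen-2 correction of an overclaim): ¬(shared 10967) ⇒ ¬(this stub) (contrapositive of the PROVED
composition, the other five stubs being true), so the stub is at least as hard as the wall; the converse is NOT
claimed — the stub bounds the WHOLE fast sector of `Π̄`, not only its `g`-component, so its failure alone would not
refute the crux (strictly stronger, by design: it is the mechanism). Degenerate checks: `σ = 0` violates it (no
records; `fd ≍ k` for all `H`); hard rods satisfy the budget but not coercivity (no 1-d gap); `g ≡ κ` is excluded
upstream (a.1). -/
def FastSectorDominance : Prop :=
  CollisionTransportIdentity →
  ∀ (a θ : ℝ) (u₀ : V3), 0 < a → 0 < θ → ∃ σ₀ : ℝ, 0 < σ₀ ∧ ∀ σ : ℝ, 0 < σ → σ < σ₀ →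
    ∃ κ₁ : ℝ, 0 < κ₁ ∧ ∃ A : ℝ, 0 ≤ A ∧ ∃ C : ℝ, 0 ≤ C ∧
      ∀ (φ : T3 → ℝ) (g : V3 → ℝ), Continuous φ → Continuous g → (∀ x, |φ x| ≤ 1) → (∀ v, |g v| ≤ κ₁) →
        (∀ (c₀ c₂ : ℝ) (b : V3),
          ∫ v, g v * (c₀ + inner ℝ b v + c₂ * ‖v‖ ^ 2) ∂(stdGaussian V3) = 0) →
        ∀ η : ℝ, 0 < η → ∃ H₁ : ℝ, 0 < H₁ ∧ ∀ H : ℝ, H₁ ≤ H →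
          ∃ N₀ : ℕ, ∀ N : ℕ, N₀ ≤ N → ∀ Φ : Flow σ N, ∃ n : ℕ, 1 ≤ n ∧
            ((N : ℝ) + 1) *
                (fastDev (windowOneBodyLaw θ u₀ Φ
                  (optimiser σ a θ u₀ N Φ φ g n (H * scale N / n)) n (H * scale N / n))).toReal ≤
              C * (klDiv (optimiser σ a θ u₀ N Φ φ g n (H * scale N / n)) (gibbs σ a θ u₀ N Φ)).toReal / H +
                A * (klDiv (optimiser σ a θ u₀ N Φ φ g n (H * scale N / n)) (gibbs σ a θ u₀ N Φ)).toReal ^ 2 /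
                  ((N : ℝ) + 1) +
                η * ((N : ℝ) + 1)

/-- Statement of `stub_discreteFejerCorrector` — **the discrete Fejér corrector turns a discrete-window exponential
moment into BOTH clauses of the crux, exactly** (TRUE, size M; the owed transfer (F0) of triage r1-3 / Disproof
(e).6 in exact discrete form). In the crux frame (`G_N` a probability measure, `|φ| ≤ 1`, `|g| ≤ κ`, `1 ≤ n`,
`lag, τ₀ > 0`): if `4κ·(n·lag) ≤ δ·τ₀ℓ_N` and `∫ exp(2·discAvg) dG_N ≤ e^{δ(N+1)}`, then
`W := −lag Σ_{k<n} (1 − k/n) F∘Φ_{k·lag}` is measurable, `|W| ≤ lag κ (N+1)(n+1)/2 ≤ κ n lag (N+1)`, satisfies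
`F − lag⁻¹(W∘Φ_lag − W) = n⁻¹ Σ_{j=1}^{n} F∘Φ_{j·lag}` on the good set (summation by parts + `Φ.flow_add`; the good
set is `G_N`-conull since `G_N ≪ liouville`), hence the DEFECT integral equals the hypothesis (`lintegral_congr_ae`),
and the COST integrand obeys `4|W|/(τ₀ℓ_N) ≤ 4κ n lag (N+1)/(τ₀ℓ_N) ≤ δ(N+1)` pointwise. No shot noise, no limit,
no passage through 10967: `lag = Hℓ_N/n` with `n` free (lag rigidity, crux NOTES S3). -/
def DiscreteFejerCorrector : Prop :=
  ∀ (σ a θ : ℝ) (u₀ : V3), 0 < σ → σ ≤ 1 / 2 → 0 < a → 0 < θ →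
    ∀ (N : ℕ) (Φ : Flow σ N) (φ : T3 → ℝ) (g : V3 → ℝ) (κ : ℝ), Continuous φ → Continuous g →
      (∀ x, |φ x| ≤ 1) → (∀ v, |g v| ≤ κ) →
      ∀ (n : ℕ) (lag δ τ₀ : ℝ), 1 ≤ n → 0 < lag → 0 < τ₀ →
        4 * κ * ((n : ℝ) * lag) ≤ δ * (τ₀ * scale N) →
        ∫⁻ z, ENNReal.ofReal (Real.exp (2 * discAvg Φ (fluxObs θ u₀ φ g N) n lag z)) ∂(gibbs σ a θ u₀ N Φ)
            ≤ ENNReal.ofReal (Real.exp (δ * (N + 1))) →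
        ∃ W : Phase N → ℝ, Measurable W ∧ (∃ C : ℝ, ∀ z, |W z| ≤ C) ∧
          ∫⁻ z, ENNReal.ofReal (Real.exp (2 * ((∑ i, φ (z i).1 * g ((Real.sqrt θ)⁻¹ • ((z i).2 - u₀))) -
              lag⁻¹ * (W (Φ.flow lag z) - W z)))) ∂(gibbs σ a θ u₀ N Φ)
            ≤ ENNReal.ofReal (Real.exp (δ * (N + 1))) ∧
          ∫⁻ z, ENNReal.ofReal (Real.exp (4 * (τ₀ * ((N + 1 : ℕ) : ℝ) ^ (-(1 / 3 : ℝ)))⁻¹ * |W z|))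
              ∂(gibbs σ a θ u₀ N Φ)
            ≤ ENNReal.ofReal (Real.exp (δ * (N + 1)))

/-! ## Registered stubs -/

/-- STUB 1 (size M; TRUE — Gibbs variational principle at the tilt + push-forward bookkeeping of the one-body law).
Sources: KipnisLandim1999 App. 1 §8 (entropy variational formula); DemboZeitouni2010 Lemma 6.2.13 (Donsker–Varadhan);
tree `Literature.Probability.Divergences.integral_le_toReal_klDiv_add_integral` (PolyanskiyWu2024 Thm 7.26). -/
theorem stub_gibbsOneBodyDuality : GibbsOneBodyDuality := by
  sorry

/-- STUB 2 (size M/L; TRUE — the card's first lemma in the crux frame). Sources: RezakhanlouVillani2008 (Golse–Olla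
foreword pp. vi–viii: chaotic densities minimise entropy at fixed marginals); Csiszar1975 / CoverThomas2006 Thm 2.5.3
(chain rule) and Thm 2.7.2 (joint convexity); KipnisLandim1999 App. 1 §8; invariance = HomogeneousInvariance
(stmt-9621) / `measurePreserving_flow_localGibbsLaw_const`. -/
theorem stub_oneBodyEntropyBudget : OneBodyEntropyBudget := by
  sorry

/-- STUB 3 (size M; TRUE — disintegration, Hellinger ≤ KL, Cauchy–Schwarz, Jensen). Sources: RezakhanlouVillani2008
Part I §1.4 (entropy vs. entropy production in `√f` variables); Tsybakov2009 Lemma 2.4 (`H² ≤ KL`); CIP1994 §3.1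
(collision invariants `a + ⟪b,v⟫ + c|v|²`, tree `mem_collisionInvariants_iff`). -/
theorem stub_hellingerBiasSplit : HellingerBiasSplit := by
  sorry

/-- STUB 4 (size M/L; TRUE — pathwise telescoping on the good set + Fubini). Sources: CIP1994 §4.2 and App. 4.A
(hard-sphere trajectories: free flight + pairwise elastic jumps, finitely many in bounded time); GST2013 Prop. 4.1.1;
PulvirentiSimonella2015 §3 Thm 1 (collision sums of the empirical measure, arXiv:1504.03215); tree
`HardSphereFlow.collisionSum`, `integral_empiricalCollisionMeasure`, `measurable_flow_prod_torus`. -/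
theorem stub_collisionTransportIdentity : CollisionTransportIdentity := by
  sorry

/-- STUB 5 (size XL; OPEN — the HARDEST, carries the kinetic-chaos content of the crux in entropy clothing:
uniform-in-N relaxation of the window optimiser's fast one-body deviation at fixed `σ`). Sources: GPV1988 /
Varadhan1993EntropyMethods / KipnisLandim1999 Ch. 5–7 (entropy method: production ⇒ Dirichlet form of `√f`);
BarangerMouhot2005 Thm 1.1 (gap; tree `le_neg_maxwellianInner_hardSphereLinearizedOp_of_orthogonal_holds`, PROVED);
DesvillettesVillani2005 (why coercivity must split off the hydrodynamic part); Villani2003 Cercignani-conjecture survey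
(defective entropy–production inequalities); BGSSCPAM2023 Thm 1.1 / BodineauEtAl2024 Thm 1.2 (linearised-Boltzmann
covariances in the Boltzmann–Grad corner = the `C`-term there); BGSSAnnals2023 (LD over Lanford's time);
GoldsteinLebowitz2004 (one-body vs Gibbs entropy, anti-Boltzmann transients); LutskoToth2020 (fixed-density horizon
wall); OllaVaradhanYau1993 §3. -/
theorem stub_fastSectorDominance : FastSectorDominance := by
  sorry

/-- STUB 6 (size M; TRUE — summation by parts, `Φ.flow_add` on the conull good set, pointwise cost bound).
Sources: Disproof.lean (e).6 (discrete Fejér corrector, `τ₀ := max(τ, 4κτ/δ)`); TRIAGE-r1-3 (F0); crux NOTES S3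
(lag rigidity); KipnisLandim1999 Ch. 7 (Fejér/resolvent correctors of the nongradient method). -/
theorem stub_discreteFejerCorrector : DiscreteFejerCorrector := by
  sorry

/-! ## Composition (sorry-free) -/

/-- Microscopic scale is positive. -/
theorem scale_pos (N : ℕ) : 0 < scale N :=
  Real.rpow_pos_of_pos (by positivity) _

/-- For nonnegative reals, `u ≤ w` follows from `u² ≤ w²`. -/
theorem le_of_sq_le_sq_of_nonneg {u w : ℝ} (hu : 0 ≤ u) (hw : 0 ≤ w) (h : u ^ 2 ≤ w ^ 2) : u ≤ w := by
  have h1 : Real.sqrt (u ^ 2) ≤ Real.sqrt (w ^ 2) := Real.sqrt_le_sqrt h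
  rwa [Real.sqrt_sq hu, Real.sqrt_sq hw] at h1

/-- Subadditivity of the square root on nonnegative reals (three terms). -/
theorem sqrt_add_three_le {x y z : ℝ} (hx : 0 ≤ x) (hy : 0 ≤ y) (hz : 0 ≤ z) :
    Real.sqrt (x + y + z) ≤ Real.sqrt x + Real.sqrt y + Real.sqrt z := by
  have hsx := Real.sqrt_nonneg x
  have hsy := Real.sqrt_nonneg y
  have hsz := Real.sqrt_nonneg z
  have hxyz : 0 ≤ x + y + z := by positivity
  refine le_of_sq_le_sq_of_nonneg (Real.sqrt_nonneg _) (by positivity) ?_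
  rw [Real.sq_sqrt hxyz]
  nlinarith [Real.sq_sqrt hx, Real.sq_sqrt hy, Real.sq_sqrt hz, mul_nonneg hsx hsy, mul_nonneg hsx hsz,
    mul_nonneg hsy hsz]

set_option maxHeartbeats 1000000 in
/-- **The κ-clause arithmetic** (pure real analysis, proved): from the one-body bias split
`E ≤ 2M(2κ√f + κc)`, the budget `M c ≤ K`, the dominance `M f ≤ C K/H + A K²/M + η M`, the amplitude clauses
`κ ≤ 1/4`, `16κ√A ≤ 1`, the window `32κ²C ≤ δH` and the slack `64κ²η ≤ δ²`, conclude `E − K ≤ δ M`.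
Chain: `4κM√f ≤ 4κ(√(MCK/H) + √A·K + √η·M) ≤ (K/4 + 16κ²MC/H) + K/4 + δM/2` (AM–GM, amplitude, slack) and
`2Mκc ≤ 2κK ≤ K/2`, `16κ²MC/H ≤ δM/2`. -/
theorem pressure_arith {M K f c κ A C H η δ E : ℝ} (hM : 0 < M) (hK : 0 ≤ K) (hf : 0 ≤ f) (_hc : 0 ≤ c)
    (hκ : 0 < κ) (hκ4 : κ ≤ 1 / 4) (hA : 0 ≤ A) (hκA : 16 * κ * Real.sqrt A ≤ 1) (hC : 0 ≤ C) (hH : 0 < H)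
    (hHC : 32 * κ ^ 2 * C ≤ δ * H) (hη : 0 ≤ η) (hηδ : 64 * κ ^ 2 * η ≤ δ ^ 2) (hδ : 0 < δ)
    (hbudget : M * c ≤ K) (hdom : M * f ≤ C * K / H + A * K ^ 2 / M + η * M)
    (hE : E ≤ 2 * M * (2 * κ * Real.sqrt f + κ * c)) :
    E - K ≤ δ * M := by
  have hM' : M ≠ 0 := hM.ne'
  have hH' : H ≠ 0 := hH.ne'
  -- the three nonnegative pieces under the square root: X = MCK/H, Y = AK², Z = ηM²
  have hX : 0 ≤ M * C * K / H := by positivity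
  have hY : 0 ≤ A * K ^ 2 := by positivity
  have hZ : 0 ≤ η * M ^ 2 := by positivity
  -- `(M√f)² ≤ X + Y + Z`
  have hMf : M * (M * f) ≤ M * C * K / H + A * K ^ 2 + η * M ^ 2 := by
    have h1 : M * (C * K / H + A * K ^ 2 / M + η * M) = M * C * K / H + A * K ^ 2 + η * M ^ 2 := by
      field_simp
    calc M * (M * f) ≤ M * (C * K / H + A * K ^ 2 / M + η * M) :=
          mul_le_mul_of_nonneg_left hdom hM.le
      _ = M * C * K / H + A * K ^ 2 + η * M ^ 2 := h1
  have hsqf : M * Real.sqrt f ≤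
      Real.sqrt (M * C * K / H) + Real.sqrt (A * K ^ 2) + Real.sqrt (η * M ^ 2) := by
    have hsum : 0 ≤ M * C * K / H + A * K ^ 2 + η * M ^ 2 := by positivity
    have h1 : M * Real.sqrt f ≤ Real.sqrt (M * C * K / H + A * K ^ 2 + η * M ^ 2) := by
      refine le_of_sq_le_sq_of_nonneg (by positivity) (Real.sqrt_nonneg _) ?_
      rw [Real.sq_sqrt hsum, mul_pow, Real.sq_sqrt hf]
      have h2 : M ^ 2 * f = M * (M * f) := by ring
      rw [h2]
      exact hMf
    exact h1.trans (sqrt_add_three_le hX hY hZ)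
  -- piece `Y`: `4κ√Y = 4κ√A·K ≤ K/4`
  have hYs : Real.sqrt (A * K ^ 2) = Real.sqrt A * K := by
    rw [Real.sqrt_mul hA, Real.sqrt_sq hK]
  have hYb : 4 * κ * Real.sqrt (A * K ^ 2) ≤ K / 4 := by
    rw [hYs]
    have h3 : 4 * κ * (Real.sqrt A * K) = (16 * κ * Real.sqrt A) * K / 4 := by ring
    rw [h3]
    have h2 : (16 * κ * Real.sqrt A) * K ≤ 1 * K := mul_le_mul_of_nonneg_right hκA hK
    linarith
  -- piece `Z`: `4κ√Z = 4κ√η·M ≤ δM/2`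
  have hZs : Real.sqrt (η * M ^ 2) = Real.sqrt η * M := by
    rw [Real.sqrt_mul hη, Real.sqrt_sq hM.le]
  have h8 : 8 * κ * Real.sqrt η ≤ δ := by
    refine le_of_sq_le_sq_of_nonneg (by positivity) hδ.le ?_
    rw [mul_pow, mul_pow, Real.sq_sqrt hη]
    nlinarith [hηδ]
  have hZb : 4 * κ * Real.sqrt (η * M ^ 2) ≤ δ * M / 2 := by
    rw [hZs]
    have h3 : 4 * κ * (Real.sqrt η * M) = (8 * κ * Real.sqrt η) * M / 2 := by ring
    rw [h3]
    have h2 : (8 * κ * Real.sqrt η) * M ≤ δ * M := mul_le_mul_of_nonneg_right h8 hM.le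
    linarith
  -- piece `X`: AM–GM `4κ√X ≤ K/4 + 16κ²MC/H`
  have hXb : 4 * κ * Real.sqrt (M * C * K / H) ≤ K / 4 + 16 * κ ^ 2 * M * C / H := by
    have hq : 0 ≤ 16 * κ ^ 2 * M * C / H := by positivity
    refine le_of_sq_le_sq_of_nonneg (by positivity) (by positivity) ?_
    have hsq : (4 * κ * Real.sqrt (M * C * K / H)) ^ 2 = 4 * (K / 4) * (16 * κ ^ 2 * M * C / H) := by
      rw [mul_pow, Real.sq_sqrt hX]
      ring
    rw [hsq]
    nlinarith [sq_nonneg (K / 4 - 16 * κ ^ 2 * M * C / H)]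
  -- the window: `16κ²MC/H ≤ δM/2`
  have hW : 16 * κ ^ 2 * M * C / H ≤ δ * M / 2 := by
    rw [div_le_iff₀ hH]
    have h2 : (32 * κ ^ 2 * C) * M ≤ (δ * H) * M := mul_le_mul_of_nonneg_right hHC hM.le
    linarith [h2]
  -- the entropy piece: `2Mκc ≤ 2κK ≤ K/2`
  have hcb : 2 * M * (κ * c) ≤ K / 2 := by
    have h2 : κ * (M * c) ≤ κ * K := mul_le_mul_of_nonneg_left hbudget hκ.le
    linarith [h2, hκ4, hK, mul_nonneg (sub_nonneg.2 hκ4) hK]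
  -- assemble
  have hmain : 2 * M * (2 * κ * Real.sqrt f) ≤ K / 4 + 16 * κ ^ 2 * M * C / H + K / 4 + δ * M / 2 := by
    have h2 : 2 * M * (2 * κ * Real.sqrt f) = 4 * κ * (M * Real.sqrt f) := by ring
    rw [h2]
    have h3 : 4 * κ * (M * Real.sqrt f) ≤ 4 * κ * (Real.sqrt (M * C * K / H) + Real.sqrt (A * K ^ 2) +
        Real.sqrt (η * M ^ 2)) :=
      mul_le_mul_of_nonneg_left hsqf (by positivity)
    linarith [h3, hXb, hYb, hZb]
  have hE' : E ≤ 2 * M * (2 * κ * Real.sqrt f) + 2 * M * (κ * c) := by linarith [hE]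
  linarith [hE', hmain, hcb, hW]

set_option maxHeartbeats 1000000 in
/-- **Composition of the line** (proved): the six stubs imply the crux body (spelled with the reducible frame
abbreviations). Choices, in the crux's quantifier order: `σ₀ := min σ₅ ½` (so `G_N` is a probability measure by the
tree theorem `isProbabilityMeasure_localGibbsLaw`); `κ := min κ₁ (16(√A+1))⁻¹`; given `φ, g, δ`:
`η := δ²/(64(κ²+1))`, `H := max H₁ (32κ²C/δ + 1)`, `τ₀ := 4κH/δ + 1`, `N₀` from the dominance stub; given
`N ≥ N₀`, `Φ`: the stub's `n`, `lag := Hℓ_N/n`, the optimiser `Q`; then budget + split + dominance +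
`pressure_arith` give `E_Q[2A] − KL(Q‖G_N) ≤ δ(N+1)`, Gibbs duality the discrete-window moment bound, and the
discrete Fejér corrector both clauses of the crux. -/
theorem correctorPressureDecay_of_parts (h₁ : GibbsOneBodyDuality) (h₂ : OneBodyEntropyBudget)
    (h₃ : HellingerBiasSplit) (h₄ : CollisionTransportIdentity) (h₅ : FastSectorDominance)
    (h₆ : DiscreteFejerCorrector) :
    ∀ (a θ : ℝ) (u₀ : V3), 0 < a → 0 < θ → ∃ σ₀ : ℝ, 0 < σ₀ ∧ ∀ σ : ℝ, 0 < σ → σ < σ₀ →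
      (∀ (N : ℕ) (Φ : Flow σ N), IsProbabilityMeasure (gibbs σ a θ u₀ N Φ)) ∧
      ∃ κ : ℝ, 0 < κ ∧ ∀ (φ : T3 → ℝ) (g : V3 → ℝ), Continuous φ → Continuous g →
        (∀ x, |φ x| ≤ 1) → (∀ v, |g v| ≤ κ) →
        (∀ (c₀ c₂ : ℝ) (b : V3),
          ∫ v, g v * (c₀ + inner ℝ b v + c₂ * ‖v‖ ^ 2) ∂(ProbabilityTheory.stdGaussian V3) = 0) →
        ∀ δ : ℝ, 0 < δ → ∃ τ₀ : ℝ, 0 < τ₀ ∧ ∃ N₀ : ℕ, ∀ N : ℕ, N₀ ≤ N → ∀ Φ : Flow σ N,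
          ∃ lag : ℝ, 0 < lag ∧ ∃ W : Phase N → ℝ, Measurable W ∧ (∃ C : ℝ, ∀ z, |W z| ≤ C) ∧
            ∫⁻ z, ENNReal.ofReal (Real.exp (2 * ((∑ i, φ (z i).1 * g ((Real.sqrt θ)⁻¹ • ((z i).2 - u₀))) -
                lag⁻¹ * (W (Φ.flow lag z) - W z)))) ∂(gibbs σ a θ u₀ N Φ)
              ≤ ENNReal.ofReal (Real.exp (δ * (N + 1))) ∧
            ∫⁻ z, ENNReal.ofReal (Real.exp (4 * (τ₀ * ((N + 1 : ℕ) : ℝ) ^ (-(1 / 3 : ℝ)))⁻¹ * |W z|))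
                ∂(gibbs σ a θ u₀ N Φ) ≤ ENNReal.ofReal (Real.exp (δ * (N + 1))) := by
  intro a θ u₀ ha hθ
  obtain ⟨σ₅, hσ₅, H₅⟩ := h₅ h₄ a θ u₀ ha hθ
  refine ⟨min σ₅ (1 / 2), lt_min hσ₅ (by norm_num), fun σ hσ hσlt => ?_⟩
  have hσ₅' : σ < σ₅ := lt_of_lt_of_le hσlt (min_le_left _ _)
  have hσhalf : σ ≤ 1 / 2 := (lt_of_lt_of_le hσlt (min_le_right _ _)).le
  have hP : ∀ (N : ℕ) (Φ : Flow σ N), IsProbabilityMeasure (gibbs σ a θ u₀ N Φ) := fun N Φ =>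
    Literature.MathematicalPhysics.KineticTheory.isProbabilityMeasure_localGibbsLaw
      continuous_const continuous_const continuous_const (fun _ => ha) (fun _ => hθ) hσhalf N Φ
  refine ⟨hP, ?_⟩
  obtain ⟨κ₁, hκ₁, A, hA, C, hC, Hφ⟩ := H₅ σ hσ hσ₅'
  -- the amplitude clause
  set κ : ℝ := min κ₁ (16 * (Real.sqrt A + 1))⁻¹ with hκdef
  have h16 : 0 < 16 * (Real.sqrt A + 1) := by positivity
  have hκpos : 0 < κ := lt_min hκ₁ (inv_pos.2 h16)
  have hκκ₁ : κ ≤ κ₁ := min_le_left _ _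
  have hκinv : κ ≤ (16 * (Real.sqrt A + 1))⁻¹ := min_le_right _ _
  have hκ16 : 16 * κ * (Real.sqrt A + 1) ≤ 1 := by
    have h1 : κ * (16 * (Real.sqrt A + 1)) ≤ (16 * (Real.sqrt A + 1))⁻¹ * (16 * (Real.sqrt A + 1)) :=
      mul_le_mul_of_nonneg_right hκinv h16.le
    rw [inv_mul_cancel₀ h16.ne'] at h1
    linarith
  have hκsA : 0 ≤ κ * Real.sqrt A := mul_nonneg hκpos.le (Real.sqrt_nonneg A)
  have hκA : 16 * κ * Real.sqrt A ≤ 1 := by linarith [hκ16, hκpos.le, hκsA]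
  have hκ4 : κ ≤ 1 / 4 := by linarith [hκ16, hκpos.le, hκsA]
  refine ⟨κ, hκpos, fun φ g hφ hg hφ1 hgκ horth δ hδ => ?_⟩
  have hgκ₁ : ∀ v, |g v| ≤ κ₁ := fun v => (hgκ v).trans hκκ₁
  -- the slack `η` and the window `H`
  set η : ℝ := δ ^ 2 / (64 * (κ ^ 2 + 1)) with hηdef
  have hηpos : 0 < η := by rw [hηdef]; positivity
  have h64 : (64 * (κ ^ 2 + 1) : ℝ) ≠ 0 := by positivity
  have hηδ : 64 * κ ^ 2 * η ≤ δ ^ 2 := by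
    have h1 : η * (64 * (κ ^ 2 + 1)) = δ ^ 2 := by
      rw [hηdef]; exact div_mul_cancel₀ _ h64
    have h2 : 0 ≤ κ ^ 2 * η := mul_nonneg (sq_nonneg κ) hηpos.le
    linarith [h1, hηpos.le, h2]
  obtain ⟨H₁, hH₁, HH⟩ := Hφ φ g hφ hg hφ1 hgκ₁ horth η hηpos
  set H : ℝ := max H₁ (32 * κ ^ 2 * C / δ + 1) with hHdef
  have hHH₁ : H₁ ≤ H := le_max_left _ _
  have hHpos : 0 < H := lt_of_lt_of_le hH₁ hHH₁
  have hHC : 32 * κ ^ 2 * C ≤ δ * H := by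
    have h1 : 32 * κ ^ 2 * C / δ + 1 ≤ H := le_max_right _ _
    have h2 : 32 * κ ^ 2 * C / δ * δ = 32 * κ ^ 2 * C := div_mul_cancel₀ _ hδ.ne'
    have h3 : (32 * κ ^ 2 * C / δ + 1) * δ ≤ H * δ := mul_le_mul_of_nonneg_right h1 hδ.le
    linarith [h2, h3, hδ]
  obtain ⟨N₀, HN⟩ := HH H hHH₁
  -- the cost scale `τ₀`
  set τ₀ : ℝ := 4 * κ * H / δ + 1 with hτ₀def
  have hτ₀pos : 0 < τ₀ := by rw [hτ₀def]; positivity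
  have hτ₀H : 4 * κ * H ≤ δ * τ₀ := by
    have h2 : τ₀ * δ = 4 * κ * H + δ := by
      rw [hτ₀def, add_mul, one_mul, div_mul_cancel₀ _ hδ.ne']
    linarith [h2, hδ]
  refine ⟨τ₀, hτ₀pos, N₀, fun N hN Φ => ?_⟩
  obtain ⟨n, hn, hdom⟩ := HN N hN Φ
  -- the lag and the optimiser
  have hnpos : (0 : ℝ) < n := by exact_mod_cast hn
  set lag : ℝ := H * scale N / n with hlagdef
  have hlag : 0 < lag := by rw [hlagdef]; exact div_pos (mul_pos hHpos (scale_pos N)) hnpos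
  have hnlag : (n : ℝ) * lag = H * scale N := by
    rw [hlagdef, mul_comm, div_mul_cancel₀ _ hnpos.ne']
  have hcost : 4 * κ * ((n : ℝ) * lag) ≤ δ * (τ₀ * scale N) := by
    rw [hnlag]
    have h1 : (4 * κ * H) * scale N ≤ (δ * τ₀) * scale N := mul_le_mul_of_nonneg_right hτ₀H (scale_pos N).le
    linarith [h1]
  haveI := hP N Φ
  obtain ⟨hQprob, hQac, hfin, hdual⟩ := h₁ σ a θ u₀ hσ hσhalf ha hθ N Φ φ g hφ hg ⟨1, hφ1⟩ ⟨κ, hgκ⟩ n lag hn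
  haveI := hQprob
  obtain ⟨hLawprob, hbudget⟩ :=
    h₂ σ a θ u₀ hσ hσhalf ha hθ N Φ n lag hn (optimiser σ a θ u₀ N Φ φ g n lag) hQprob
  haveI := hLawprob
  -- abbreviations for the real numbers in play
  set Q := optimiser σ a θ u₀ N Φ φ g n lag with hQdef
  set Law := windowOneBodyLaw θ u₀ Φ Q n lag with hLawdef
  set K : ℝ := (klDiv Q (gibbs σ a θ u₀ N Φ)).toReal with hKdef
  have hK : 0 ≤ K := ENNReal.toReal_nonneg
  -- finiteness of the conditional entropy of `Π̄`
  have hone : (1 : ℝ≥0∞) ≤ ((N + 1 : ℕ) : ℝ≥0∞) := by exact_mod_cast Nat.succ_le_succ (Nat.zero_le N)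
  have hcondle : condKL Law ≤ klDiv Q (gibbs σ a θ u₀ N Φ) :=
    le_trans (le_mul_of_one_le_left bot_le hone) hbudget
  have hcondfin : condKL Law ≠ ∞ := ne_top_of_le_ne_top hfin hcondle
  -- the split
  obtain ⟨hfdfin, hsplit⟩ :=
    h₃ Law hLawprob hcondfin φ g κ hφ.measurable hg.measurable hφ1 hgκ horth
  -- real forms of budget and dominance
  set M : ℝ := (N : ℝ) + 1 with hMdef
  have hMpos : 0 < M := by rw [hMdef]; positivity
  set c : ℝ := (condKL Law).toReal with hcdef
  set f : ℝ := (fastDev Law).toReal with hfdef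
  have hc : 0 ≤ c := ENNReal.toReal_nonneg
  have hf : 0 ≤ f := ENNReal.toReal_nonneg
  have hbudgetR : M * c ≤ K := by
    have h1 := ENNReal.toReal_mono hfin hbudget
    rw [ENNReal.toReal_mul] at h1
    have h2 : (((N + 1 : ℕ) : ℝ≥0∞)).toReal = M := by
      rw [hMdef, ENNReal.toReal_natCast, Nat.cast_add, Nat.cast_one]
    rw [h2] at h1
    exact h1
  have hdomR : M * f ≤ C * K / H + A * K ^ 2 / M + η * M := hdom
  have hE : 2 * M * ∫ p, φ p.1 * g p.2 ∂Law ≤ 2 * M * (2 * κ * Real.sqrt f + κ * c) :=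
    mul_le_mul_of_nonneg_left hsplit (by positivity)
  have hfinal : 2 * M * ∫ p, φ p.1 * g p.2 ∂Law - K ≤ δ * M :=
    pressure_arith hMpos hK hf hc hκpos hκ4 hA hκA hC hHpos hHC hηpos.le hηδ hδ hbudgetR hdomR hE
  -- Gibbs duality: the discrete-window exponential moment
  have hmoment : ∫⁻ z, ENNReal.ofReal (Real.exp (2 * discAvg Φ (fluxObs θ u₀ φ g N) n lag z))
      ∂(gibbs σ a θ u₀ N Φ) ≤ ENNReal.ofReal (Real.exp (δ * (N + 1))) := by
    have h1 := hdual (δ * M) hfinal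
    rw [hMdef] at h1
    exact h1
  -- the discrete Fejér corrector: both clauses of the crux
  obtain ⟨W, hWm, hWb, hdef, hcostW⟩ :=
    h₆ σ a θ u₀ hσ hσhalf ha hθ N Φ φ g κ hφ hg hφ1 hgκ n lag δ τ₀ hn hlag hτ₀pos hcost hmoment
  exact ⟨lag, hlag, W, hWm, hWb, hdef, hcostW⟩

/-- **The skeleton concludes the crux BY NAME.** `CorrectorPressureDecay` (route `AntiMazurCoboundaries`,
stmt-AtomisticToContinuum-14135) from the six registered stubs. -/
theorem CorrectorPressureDecay_of : CorrectorPressureDecay :=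
  correctorPressureDecay_of_parts stub_gibbsOneBodyDuality stub_oneBodyEntropyBudget stub_hellingerBiasSplit
    stub_collisionTransportIdentity stub_fastSectorDominance stub_discreteFejerCorrector

end Summit.AtomisticToContinuum.HydrodynamicLimit.Cruxes.CorrectorPressureDecay.KineticEntropyCollisionBudget

end
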